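import Mathlib.RepresentationTheory.Irreducible
import Literature.NumberTheory.Automorphic.HeckeAlgebra
import HarnessLib

/-!
# An injective intertwiner makes two representations Hecke-related at a compact open level
(Bushnell–Henniart, *The local Langlands conjecture for GL(2)* (2006), §4.2–4.3: the functor `V ↦ V^K` to modules over
the Hecke algebra `ℋ(G, K)`; Cartier, Corvallis (1979), §I.3, §IV)

Topic `NumberTheory/Automorphic`; PROOF FILE (theorems only, no definition, no named fact, no instance, no `sorry`)
over ★ `HeckeAlgebra` (`heckeOperator`, `isHeckeTriple_top_of_isCompact_isOpen`, `finite_orbit_quotient`) and ★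
`SmoothRepresentation` (`Representation.fixedPoints`, `IsSmooth`, `stabilizerSubgroup`).

For representations `σ`, `σ'` of a topological group `G` and an EQUIVARIANT linear map `φ : σ → σ'`:
* `map_mem_fixedPoints_of_equivariant` — `φ (σ^K) ⊆ σ'^K`;
* `map_heckeOperator_of_isCompact_isOpen` — for `K` compact open, `φ ∘ [KgK]_σ = [KgK]_{σ'} ∘ φ` on ALL vectors (the
  `K`-orbit of `gK` is finite, so both Hecke operators are honest finite sums of translates; the tree's
  `map_heckeOperator_apply` of `HeckeEigenvectorProjection` proves the same for every `K` — reproved here at compact open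
  `K` to keep this file's imports to `HeckeAlgebra`);
* `exists_isCompact_isOpen_le_stabilizerSubgroup` — a smooth vector is fixed by a COMPACT open subgroup as soon as `G`
  has one compact open subgroup (`K₀ ∩ Stab(w)`);
* **`exists_heckeRelated_of_injective`** — if `σ` is smooth with a non-zero vector, `G` has a compact open subgroup and
  `φ` is INJECTIVE and equivariant, then at some compact open `K` the pair `(σ, σ')` is HECKE-RELATED: `φ` maps `σ^K` to
  `σ'^K`, commutes there with every `[KgK]`, and is non-zero on `σ^K` — exactly the shape `HeckeRelatedAt K σ σ'` consumed
  by the Hodge programme's crux `H413` lines (stated here unfolded, token for token) and the hypothesis shape of ★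
  `HeckeFixedVectorsLift.nonempty_equiv_of_heckeEquivariant`; `…_of_isIrreducible` — the same for `σ` irreducible
  (irreducible ⇒ non-zero space).

References: [BushnellHenniart2006] §4.2–4.3; [Cartier1979] §I.3, §IV; [BernsteinZelevinsky1976] §2.1.
-/

noncomputable section

namespace Literature.NumberTheory.Automorphic

open Representation

section Equivariant

variable {k G V V' : Type*} [CommRing k] [Group G] [AddCommGroup V] [Module k V] [AddCommGroup V'] [Module k V']
  (ρ : Representation k G V) (ρ' : Representation k G V') (K : Subgroup G)
  (φ : V →ₗ[k] V') (hφ : ∀ (g : G) (v : V), φ (ρ g v) = ρ' g (φ v))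
include hφ

/-- An equivariant linear map sends `K`-fixed vectors to `K`-fixed vectors (Bushnell–Henniart (2006), §4.2: `V ↦ V^K`
is a functor). [cite: BushnellHenniart2006, §4.2] -/
theorem map_mem_fixedPoints_of_equivariant {v : V} (hv : v ∈ ρ.fixedPoints K) : φ v ∈ ρ'.fixedPoints K := by
  rw [Representation.mem_fixedPoints] at hv ⊢
  intro g hg
  rw [← hφ, hv g hg]

/-- **An equivariant linear map intertwines the Hecke operators `[KgK]` at a compact open level `K`** — on every
vector: the `K`-orbit of `gK` in `G ⧸ K` is finite (`isHeckeTriple_top_of_isCompact_isOpen`, `finite_orbit_quotient`),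
so `[KgK] = ∑_{yK ⊆ KgK} ρ(y)` is a finite sum of translates with the SAME representatives `Quotient.out` on both sides
(Bushnell–Henniart (2006), §4.2; Cartier (1979), §IV). [cite: BushnellHenniart2006, §4.2] -/
theorem map_heckeOperator_of_isCompact_isOpen [TopologicalSpace G] [IsTopologicalGroup G]
    (hKc : IsCompact (K : Set G)) (hKo : IsOpen (K : Set G)) (g : G) (v : V) :
    φ (heckeOperator ρ K g v) = heckeOperator ρ' K g (φ v) := by
  classical
  haveI : IsHeckeTriple (⊤ : Submonoid G) K K := isHeckeTriple_top_of_isCompact_isOpen K hKc hKo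
  have hfin : (MulAction.orbit K (g : G ⧸ K)).Finite := finite_orbit_quotient K g
  rw [heckeOperator, heckeOperator, finsum_mem_eq_finite_toFinset_sum _ hfin,
    finsum_mem_eq_finite_toFinset_sum _ hfin, LinearMap.sum_apply, LinearMap.sum_apply, map_sum]
  exact Finset.sum_congr rfl fun y _ => hφ _ _

end Equivariant

section Smooth

variable {k G V V' : Type*} [Field k] [Group G] [TopologicalSpace G] [IsTopologicalGroup G]
  [AddCommGroup V] [Module k V] [AddCommGroup V'] [Module k V']
  (ρ : Representation k G V) (ρ' : Representation k G V')

/-- In a topological group possessing a compact open subgroup `K₀`, every SMOOTH vector `w` is fixed by a COMPACT open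
subgroup, namely `K₀ ∩ Stab(w)` (open as an intersection of opens, compact as a closed — because open — subgroup of
`K₀`) (Bernstein–Zelevinsky (1976), §2.1; Bushnell–Henniart (2006), §1.1). [cite: BernsteinZelevinsky1976, §2.1] -/
theorem exists_isCompact_isOpen_le_stabilizerSubgroup (K₀ : Subgroup G) (hK₀c : IsCompact (K₀ : Set G))
    (hK₀o : IsOpen (K₀ : Set G)) {w : V} (hw : ρ.IsSmoothVector w) :
    ∃ K : Subgroup G, IsCompact (K : Set G) ∧ IsOpen (K : Set G) ∧ K ≤ ρ.stabilizerSubgroup w := by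
  refine ⟨K₀ ⊓ ρ.stabilizerSubgroup w, ?_, ?_, inf_le_right⟩
  · have ho : IsOpen ((K₀ ⊓ ρ.stabilizerSubgroup w : Subgroup G) : Set G) := by
      rw [Subgroup.coe_inf]
      exact hK₀o.inter hw
    exact hK₀c.of_isClosed_subset ((K₀ ⊓ ρ.stabilizerSubgroup w).isClosed_of_isOpen ho)
      (by rw [Subgroup.coe_inf]; exact Set.inter_subset_left)
  · rw [Subgroup.coe_inf]
    exact hK₀o.inter hw

/-- **An injective intertwiner makes `σ` and `σ'` Hecke-related at a compact open level.** Let `G` have a compact open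
subgroup `K₀`, let `ρ` be SMOOTH with a non-zero vector `w`, and let `φ : V → V'` be an INJECTIVE equivariant linear map.
Then for the compact open `K := K₀ ∩ Stab(w)`: `φ` maps `ρ^K` into `ρ'^K`, commutes on `ρ^K` with every Hecke operator
`[KgK]`, and is non-zero on `ρ^K` (at `w`).  This is, token for token, `∃ K, IsOpen K ∧ IsCompact K ∧ HeckeRelatedAt K ρ ρ'`
of the Hodge programme's crux-`H413` lines, and the hypothesis shape of ★
`HeckeFixedVectorsLift.nonempty_equiv_of_heckeEquivariant` (Bushnell–Henniart (2006), §4.3 Proposition: between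
irreducibles such data come from an isomorphism). [cite: BushnellHenniart2006, §4.2–4.3] -/
theorem exists_heckeRelated_of_injective (K₀ : Subgroup G) (hK₀c : IsCompact (K₀ : Set G))
    (hK₀o : IsOpen (K₀ : Set G)) (hρ : ρ.IsSmooth) {w : V} (hw : w ≠ 0)
    (φ : V →ₗ[k] V') (hφ : ∀ (g : G) (v : V), φ (ρ g v) = ρ' g (φ v)) (hinj : Function.Injective φ) :
    ∃ K : Subgroup G, IsOpen (K : Set G) ∧ IsCompact (K : Set G) ∧
      ∃ ψ : V →ₗ[k] V', (∀ v ∈ ρ.fixedPoints K, ψ v ∈ ρ'.fixedPoints K) ∧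
        (∀ g : G, ∀ v ∈ ρ.fixedPoints K, ψ (heckeOperator ρ K g v) = heckeOperator ρ' K g (ψ v)) ∧
        ∃ v ∈ ρ.fixedPoints K, ψ v ≠ 0 := by
  obtain ⟨K, hKc, hKo, hKle⟩ := exists_isCompact_isOpen_le_stabilizerSubgroup ρ K₀ hK₀c hK₀o (hρ w)
  refine ⟨K, hKo, hKc, φ, fun v hv => map_mem_fixedPoints_of_equivariant ρ ρ' K φ hφ hv,
    fun g v _ => map_heckeOperator_of_isCompact_isOpen ρ ρ' K φ hφ hKc hKo g v,
    w, (ρ.mem_fixedPoints_iff_le_stabilizerSubgroup K w).mpr hKle, ?_⟩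
  rw [← map_zero φ]
  exact fun h => hw (hinj h)

omit [TopologicalSpace G] [IsTopologicalGroup G] in
/-- An irreducible representation lives on a non-zero space (`⊥ ≠ ⊤` among its subrepresentations; Mathlib
`Representation.IsIrreducible = IsSimpleOrder`). [cite: BushnellHenniart2006, §4.3] -/
theorem exists_ne_zero_of_isIrreducible (hirr : ρ.IsIrreducible) : ∃ w : V, w ≠ 0 := by
  haveI := hirr
  by_contra h
  push Not at h
  haveI : Subsingleton V := ⟨fun a b => by rw [h a, h b]⟩
  exact (IsSimpleOrder.bot_ne_top (α := Subrepresentation ρ))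
    (Subrepresentation.toSubmodule_injective (Subsingleton.elim _ _))

/-- **Irreducible smooth `σ` embedded in `σ'` is Hecke-related to `σ'` at some compact open level** — the form in
which the crux-`H413` engine socket consumes an injective intertwiner `σ ↪ ω(μ, ε, χ)_f` (`G = U(V)(𝔸_f)` has compact
open subgroups). [cite: BushnellHenniart2006, §4.2–4.3] -/
theorem exists_heckeRelated_of_injective_of_isIrreducible (K₀ : Subgroup G) (hK₀c : IsCompact (K₀ : Set G))
    (hK₀o : IsOpen (K₀ : Set G)) (hirr : ρ.IsIrreducible) (hρ : ρ.IsSmooth)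
    (φ : V →ₗ[k] V') (hφ : ∀ (g : G) (v : V), φ (ρ g v) = ρ' g (φ v)) (hinj : Function.Injective φ) :
    ∃ K : Subgroup G, IsOpen (K : Set G) ∧ IsCompact (K : Set G) ∧
      ∃ ψ : V →ₗ[k] V', (∀ v ∈ ρ.fixedPoints K, ψ v ∈ ρ'.fixedPoints K) ∧
        (∀ g : G, ∀ v ∈ ρ.fixedPoints K, ψ (heckeOperator ρ K g v) = heckeOperator ρ' K g (ψ v)) ∧
        ∃ v ∈ ρ.fixedPoints K, ψ v ≠ 0 := by
  obtain ⟨w, hw⟩ := exists_ne_zero_of_isIrreducible ρ hirr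
  exact exists_heckeRelated_of_injective ρ ρ' K₀ hK₀c hK₀o hρ hw φ hφ hinj

/-- Bundled-intertwiner form: an injective `f : ρ.IntertwiningMap ρ'` out of an irreducible smooth `ρ`.
[cite: BushnellHenniart2006, §4.2–4.3] -/
theorem exists_heckeRelated_of_intertwiningMap (K₀ : Subgroup G) (hK₀c : IsCompact (K₀ : Set G))
    (hK₀o : IsOpen (K₀ : Set G)) (hirr : ρ.IsIrreducible) (hρ : ρ.IsSmooth)
    (f : ρ.IntertwiningMap ρ') (hinj : Function.Injective f) :
    ∃ K : Subgroup G, IsOpen (K : Set G) ∧ IsCompact (K : Set G) ∧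
      ∃ ψ : V →ₗ[k] V', (∀ v ∈ ρ.fixedPoints K, ψ v ∈ ρ'.fixedPoints K) ∧
        (∀ g : G, ∀ v ∈ ρ.fixedPoints K, ψ (heckeOperator ρ K g v) = heckeOperator ρ' K g (ψ v)) ∧
        ∃ v ∈ ρ.fixedPoints K, ψ v ≠ 0 :=
  exists_heckeRelated_of_injective_of_isIrreducible ρ ρ' K₀ hK₀c hK₀o hirr hρ f.toLinearMap
    (fun g v => Representation.IntertwiningMap.isIntertwining ρ ρ' f g v) hinj

end Smooth

end Literature.NumberTheory.Automorphic

end
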